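import Mathlib.Analysis.SpecialFunctions.Pow.Real
import Mathlib.Order.CompleteLattice.Basic
import Mathlib.Data.EReal.Basic
import Literature.Geometry.Riemannian.CanonicalNeighbourhoods
import Literature.Geometry.Lorentzian.VolumeProofs
import Literature.Geometry.Lorentzian.VolumePositivity
import HarnessLib

/-!
# Perelman's `𝒲`-entropy, compatibility, `μ(g, τ)` and `ν(g, τ₀)`
# (Perelman 2002, §3.1; Topping 2006, §8.1)

Definitions (real, with bodies) of the objects of Perelman's entropy formula, over the metric
vocabulary of `Literature/Geometry/{Lorentzian,Riemannian}` (`PseudoRiemannianMetric`, explicit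
Levi-Civita witnesses `cov` as in `IsRicciFlow`, the Riemannian measure `g.riemVolume` of
`CanonicalNeighbourhoods.lean`, the scalar curvature `g.scalarCurvatureWith cov` of
`RicciFlowScalarCurvature.lean` and the gradient square `g.gradSq f = g⁻¹(df, df) = |∇f|²_g` of
`EnergyCurrents.lean`):

* `entropyDensity n f τ x = u(x) = (4πτ)^{-n/2} e^{-f(x)}` — Perelman's density (Topping 2006,
  (8.1.1); Perelman 2002, §3.1, "`u = (4πτ)^{-n/2} e^{-f}`");
* `g.wEntropy cov f τ = 𝒲(g, f, τ) = ∫_M [τ(R + |∇f|²) + f - n] u dV` — **Perelman's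
  `𝒲`-functional** (Perelman 2002, (3.1); Topping 2006, §8.1), a Bochner integral against
  `dV = g.riemVolume`, `n = dim M = finrank ℝ E`;
* `g.IsEntropyCompatible f τ` — **compatibility** `∫_M u dV = 1` (Topping 2006, Def. 8.1.1;
  Perelman 2002, (3.2));
* `g.muEntropy cov τ = μ(g, τ) = inf {𝒲(g, f, τ) | f smooth, compatible}` (Perelman 2002, §3.1:
  "`μ(g_ij, τ) = inf 𝒲(g_ij, f, τ)` over smooth `f` satisfying (3.2)"; Topping 2006, (8.1.6)),
  valued in `EReal` (the infimum over the empty family is `⊤`; that it is `> -∞` on a closed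
  manifold is Perelman's claim / Topping's Lemma 8.1.8, NOT proved here);
* `g.nuEntropy cov τ₀ = ν(g, τ₀) = inf_{τ ∈ (0, τ₀]} μ(g, τ)` (Topping 2006, (8.1.7)).

Proved API: positivity and the closed form of `u`; the integral of `u` for a constant `f`
(`integral_entropyDensity_const`); on a nonempty closed Riemannian manifold a compatible
*constant* exists (`exists_const_isEntropyCompatible`, using `0 < Vol(M) < ∞` from
`VolumePositivity.lean` / `VolumeProofs.lean`), whence `μ(g, τ) < ⊤` (`muEntropy_lt_top`);
`μ ≤ 𝒲(f)` for admissible `f` (`muEntropy_le`); `ν ≤ μ` (`nuEntropy_le_muEntropy`); the value of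
`𝒲` at a compatible constant, `𝒲(g, c, τ) = τ ∫ R u dV + c - n` (`wEntropy_const`).

What is NOT here (the analytic theory, cf. the module docstring of
`CanonicalNeighbourhoodsProofs.lean`): scale invariance `𝒲(g,f,τ) = 𝒲(τ⁻¹g,f,1)` (Topping
Prop. 8.1.2: needs the scaling law of the Hausdorff/Riemannian measure), existence of minimisers
and `μ > -∞` (Lemma 8.1.8), the entropy formula `d𝒲/dt = ∫ 2τ|Ric + Hess f - g/2τ|² u dV`
(Perelman (3.4), Topping Prop. 8.2.1) and the monotonicity of `μ` along the Ricci flow.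

## References

* G. Perelman, *The entropy formula for the Ricci flow and its geometric applications*,
  arXiv:math/0211159 (2002), §3.1, (3.1)–(3.4) and the definition of `μ`, `ν`. [Perelman2002]
* P. Topping, *Lectures on the Ricci flow*, LMS Lecture Note Series 325, CUP 2006, §8.1:
  (8.1.1), Def. 8.1.1, Prop. 8.1.2, Lemma 8.1.8, (8.1.6), (8.1.7). [Topping2006]
-/

noncomputable section

open Bundle Set Module Filter MeasureTheory Manifold
open scoped ContDiff Topology ENNReal NNReal

namespace Literature.Geometry.Riemannian

open Lorentzian

/-! ### The density `u = (4πτ)^{-n/2} e^{-f}` -/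

section Density

variable {M : Type*}

/-- **Perelman's density** `u = (4πτ)^{-n/2} e^{-f}` attached to a function `f : M → ℝ`, a
scale `τ` and the dimension `n` (Topping 2006, (8.1.1); Perelman 2002, §3.1). For `τ ≤ 0` the
real power `(4πτ)^{-n/2}` is Mathlib's junk-valued `Real.rpow`; only `τ > 0` is ever used.
[cite: Topping2006, §8.1, (8.1.1)] -/
def entropyDensity (n : ℕ) (f : M → ℝ) (τ : ℝ) (x : M) : ℝ :=
  (4 * Real.pi * τ) ^ (-(n : ℝ) / 2) * Real.exp (-f x)

/-- Unfolding of the density. [cite: Topping2006, §8.1, (8.1.1)] -/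
theorem entropyDensity_apply (n : ℕ) (f : M → ℝ) (τ : ℝ) (x : M) :
    entropyDensity n f τ x = (4 * Real.pi * τ) ^ (-(n : ℝ) / 2) * Real.exp (-f x) := rfl

/-- The normalising constant `(4πτ)^{-n/2}` is positive for `τ > 0`. [folklore] -/
theorem entropyNormalisation_pos (n : ℕ) {τ : ℝ} (hτ : 0 < τ) :
    0 < (4 * Real.pi * τ) ^ (-(n : ℝ) / 2) :=
  Real.rpow_pos_of_pos (by positivity) _

/-- The density is positive (for `τ > 0`). [folklore] -/
theorem entropyDensity_pos (n : ℕ) (f : M → ℝ) {τ : ℝ} (hτ : 0 < τ) (x : M) :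
    0 < entropyDensity n f τ x :=
  mul_pos (entropyNormalisation_pos n hτ) (Real.exp_pos _)

/-- The density of a constant function is the constant `(4πτ)^{-n/2} e^{-c}`. [folklore] -/
theorem entropyDensity_const (n : ℕ) (c τ : ℝ) :
    entropyDensity n (fun _ : M ↦ c) τ = fun _ ↦ (4 * Real.pi * τ) ^ (-(n : ℝ) / 2) * Real.exp (-c) :=
  rfl

/-- `f = -log u - (n/2) log(4πτ)`: the density determines `f` (for `τ > 0`). [folklore] -/
theorem neg_log_entropyDensity (n : ℕ) (f : M → ℝ) {τ : ℝ} (hτ : 0 < τ) (x : M) :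
    -Real.log (entropyDensity n f τ x) = f x + (n : ℝ) / 2 * Real.log (4 * Real.pi * τ) := by
  rw [entropyDensity_apply, Real.log_mul (entropyNormalisation_pos n hτ).ne' (Real.exp_pos _).ne',
    Real.log_exp, Real.log_rpow (by positivity)]
  ring

end Density

/-! ### The `𝒲`-functional, compatibility, `μ` and `ν` -/

section Entropy

variable {E : Type*} [NormedAddCommGroup E] [NormedSpace ℝ E] [FiniteDimensional ℝ E]
  {H : Type*} [TopologicalSpace H] {I : ModelWithCorners ℝ E H} {M : Type*} [TopologicalSpace M]
  [ChartedSpace H M] [IsManifold I ∞ M] [T3Space M] [MeasurableSpace M] [BorelSpace M]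

/-- **Perelman's `𝒲`-entropy** `𝒲(g, f, τ) = ∫_M [τ(R + |∇f|²) + f - n] (4πτ)^{-n/2} e^{-f} dV`
(Perelman 2002, (3.1); Topping 2006, §8.1, first display), for a metric `g` with connection
`cov` (a Levi-Civita witness in all uses, so that `R = g.scalarCurvatureWith cov` is the scalar
curvature of `g`), `|∇f|² = g.gradSq f = g⁻¹(df, df)`, `n = finrank ℝ E`, and `dV = g.riemVolume`
the Riemannian measure (junk `0` for non-Riemannian `g`). A Bochner integral: it is the printed
quantity whenever the integrand is integrable (e.g. `f` smooth on a closed manifold) and the junk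
value `0` otherwise. [cite: Perelman2002, §3.1, (3.1)] -/
def _root_.Literature.Geometry.Lorentzian.PseudoRiemannianMetric.wEntropy
    (g : PseudoRiemannianMetric I ∞ E (TangentSpace I : M → Type _))
    (cov : CovariantDerivative I E (TangentSpace I : M → Type _)) (f : M → ℝ) (τ : ℝ) : ℝ :=
  ∫ x, (τ * (g.scalarCurvatureWith cov x + g.gradSq f x) + f x - finrank ℝ E) *
    entropyDensity (finrank ℝ E) f τ x ∂g.riemVolume

/-- Unfolding of `𝒲`. [cite: Perelman2002, §3.1, (3.1)] -/
theorem _root_.Literature.Geometry.Lorentzian.PseudoRiemannianMetric.wEntropy_def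
    (g : PseudoRiemannianMetric I ∞ E (TangentSpace I : M → Type _))
    (cov : CovariantDerivative I E (TangentSpace I : M → Type _)) (f : M → ℝ) (τ : ℝ) :
    g.wEntropy cov f τ =
      ∫ x, (τ * (g.scalarCurvatureWith cov x + g.gradSq f x) + f x - finrank ℝ E) *
        entropyDensity (finrank ℝ E) f τ x ∂g.riemVolume := rfl

/-- **Compatibility** of `(g, f, τ)` (Topping 2006, Def. 8.1.1; Perelman 2002, (3.2)):
`∫_M u dV = ∫_M (4πτ)^{-n/2} e^{-f} dV = 1`. (As a Bochner integral the condition forces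
integrability of `u`, a non-integrable `u` having integral `0 ≠ 1`.) [cite: Topping2006, §8.1, Def. 8.1.1] -/
def _root_.Literature.Geometry.Lorentzian.PseudoRiemannianMetric.IsEntropyCompatible
    (g : PseudoRiemannianMetric I ∞ E (TangentSpace I : M → Type _)) (f : M → ℝ) (τ : ℝ) : Prop :=
  ∫ x, entropyDensity (finrank ℝ E) f τ x ∂g.riemVolume = 1

/-- Unfolding of compatibility. [cite: Topping2006, §8.1, Def. 8.1.1] -/
theorem _root_.Literature.Geometry.Lorentzian.PseudoRiemannianMetric.isEntropyCompatible_iff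
    (g : PseudoRiemannianMetric I ∞ E (TangentSpace I : M → Type _)) (f : M → ℝ) (τ : ℝ) :
    g.IsEntropyCompatible f τ ↔ ∫ x, entropyDensity (finrank ℝ E) f τ x ∂g.riemVolume = 1 :=
  Iff.rfl

/-- A compatible density is integrable. [folklore] -/
theorem _root_.Literature.Geometry.Lorentzian.PseudoRiemannianMetric.IsEntropyCompatible.integrable
    {g : PseudoRiemannianMetric I ∞ E (TangentSpace I : M → Type _)} {f : M → ℝ} {τ : ℝ}
    (h : g.IsEntropyCompatible f τ) : Integrable (entropyDensity (finrank ℝ E) f τ) g.riemVolume := by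
  by_contra hni
  have := integral_undef hni
  rw [h] at this
  exact one_ne_zero this

/-- The **admissible functions** for `μ(g, τ)`: smooth and compatible (Perelman 2002, §3.1:
"over smooth `f` satisfying (3.2)"). [cite: Perelman2002, §3.1, definition of μ] -/
def _root_.Literature.Geometry.Lorentzian.PseudoRiemannianMetric.entropyAdmissible
    (g : PseudoRiemannianMetric I ∞ E (TangentSpace I : M → Type _)) (τ : ℝ) : Set (M → ℝ) :=
  {f | ContMDiff I 𝓘(ℝ, ℝ) ∞ f ∧ g.IsEntropyCompatible f τ}

/-- Membership in the admissible class. [cite: Perelman2002, §3.1, definition of μ] -/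
theorem _root_.Literature.Geometry.Lorentzian.PseudoRiemannianMetric.mem_entropyAdmissible
    {g : PseudoRiemannianMetric I ∞ E (TangentSpace I : M → Type _)} {τ : ℝ} {f : M → ℝ} :
    f ∈ g.entropyAdmissible τ ↔ ContMDiff I 𝓘(ℝ, ℝ) ∞ f ∧ g.IsEntropyCompatible f τ :=
  Iff.rfl

/-- **Perelman's `μ`-functional** `μ(g, τ) = inf {𝒲(g, f, τ) | f smooth, (g, f, τ) compatible}`
(Perelman 2002, §3.1; Topping 2006, (8.1.6)), as an extended real: `⊤` if no smooth compatible
`f` exists (e.g. `M = ∅`), and a priori possibly `-∞` — that `μ(g, τ) > -∞` on a closed manifold,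
locally uniformly in `τ`, is Perelman's claim (§3.1) / Topping's Lemma 8.1.8, not proved in this
file. [cite: Perelman2002, §3.1, definition of μ] -/
def _root_.Literature.Geometry.Lorentzian.PseudoRiemannianMetric.muEntropy
    (g : PseudoRiemannianMetric I ∞ E (TangentSpace I : M → Type _))
    (cov : CovariantDerivative I E (TangentSpace I : M → Type _)) (τ : ℝ) : EReal :=
  ⨅ f : g.entropyAdmissible τ, ((g.wEntropy cov f.1 τ : ℝ) : EReal)

/-- **Perelman's `ν`-functional on a bounded range of scales**,
`ν(g, τ₀) = inf_{τ ∈ (0, τ₀]} μ(g, τ)` (Topping 2006, (8.1.7); Perelman 2002, §3.1 takes the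
infimum over all `τ > 0`). [cite: Topping2006, §8.1, (8.1.7)] -/
def _root_.Literature.Geometry.Lorentzian.PseudoRiemannianMetric.nuEntropy
    (g : PseudoRiemannianMetric I ∞ E (TangentSpace I : M → Type _))
    (cov : CovariantDerivative I E (TangentSpace I : M → Type _)) (τ₀ : ℝ) : EReal :=
  ⨅ τ : Ioc (0 : ℝ) τ₀, g.muEntropy cov τ

variable {g : PseudoRiemannianMetric I ∞ E (TangentSpace I : M → Type _)}
  {cov : CovariantDerivative I E (TangentSpace I : M → Type _)}

/-- `μ(g, τ) ≤ 𝒲(g, f, τ)` for every smooth compatible `f`. [cite: Perelman2002, §3.1, definition of μ] -/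
theorem _root_.Literature.Geometry.Lorentzian.PseudoRiemannianMetric.muEntropy_le
    {τ : ℝ} {f : M → ℝ} (hf : ContMDiff I 𝓘(ℝ, ℝ) ∞ f) (hc : g.IsEntropyCompatible f τ) :
    g.muEntropy cov τ ≤ ((g.wEntropy cov f τ : ℝ) : EReal) :=
  iInf_le (fun f : g.entropyAdmissible τ ↦ ((g.wEntropy cov f.1 τ : ℝ) : EReal)) ⟨f, hf, hc⟩

/-- `μ(g, τ)` is the greatest lower bound: `a ≤ μ(g, τ)` iff `a ≤ 𝒲(g, f, τ)` for all smooth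
compatible `f`. [cite: Perelman2002, §3.1, definition of μ] -/
theorem _root_.Literature.Geometry.Lorentzian.PseudoRiemannianMetric.le_muEntropy_iff
    {τ : ℝ} {a : EReal} :
    a ≤ g.muEntropy cov τ ↔ ∀ f : M → ℝ, ContMDiff I 𝓘(ℝ, ℝ) ∞ f → g.IsEntropyCompatible f τ →
      a ≤ ((g.wEntropy cov f τ : ℝ) : EReal) := by
  rw [PseudoRiemannianMetric.muEntropy, le_iInf_iff]
  exact ⟨fun h f hf hc ↦ h ⟨f, hf, hc⟩, fun h f ↦ h f.1 f.2.1 f.2.2⟩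

/-- `ν(g, τ₀) ≤ μ(g, τ)` for `0 < τ ≤ τ₀`. [cite: Topping2006, §8.1, (8.1.7)] -/
theorem _root_.Literature.Geometry.Lorentzian.PseudoRiemannianMetric.nuEntropy_le_muEntropy
    {τ₀ τ : ℝ} (hτ : 0 < τ) (hττ₀ : τ ≤ τ₀) : g.nuEntropy cov τ₀ ≤ g.muEntropy cov τ :=
  iInf_le (fun τ : Ioc (0 : ℝ) τ₀ ↦ g.muEntropy cov τ) ⟨τ, hτ, hττ₀⟩

/-! ### Constant test functions -/

/-- `∫_M u dV` for a constant `f ≡ c`: `(4πτ)^{-n/2} e^{-c} · Vol(M)` (with `Vol(M).toReal`,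
so `0` if the volume is infinite). [folklore] -/
theorem integral_entropyDensity_const (g : PseudoRiemannianMetric I ∞ E (TangentSpace I : M → Type _))
    (c τ : ℝ) :
    ∫ x, entropyDensity (finrank ℝ E) (fun _ : M ↦ c) τ x ∂g.riemVolume =
      (g.riemVolume univ).toReal * ((4 * Real.pi * τ) ^ (-(finrank ℝ E : ℝ) / 2) * Real.exp (-c)) := by
  rw [entropyDensity_const, integral_const, smul_eq_mul, Measure.real]

/-- **The volume of a closed Riemannian manifold is finite**: `Vol(M) < ∞` for `g` Riemannian on
a compact manifold (`riemannianVolume_lt_top_of_isCompact_holds`, Federer 1969, §3.2.46); also in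
the junk case. [folklore] -/
theorem _root_.Literature.Geometry.Lorentzian.PseudoRiemannianMetric.riemVolume_univ_lt_top
    [CompactSpace M] (g : PseudoRiemannianMetric I ∞ E (TangentSpace I : M → Type _)) :
    g.riemVolume univ < ⊤ := by
  by_cases hg : g.IsRiemannian
  · rw [PseudoRiemannianMetric.riemVolume_eq hg]
    exact riemannianVolume_lt_top_of_isCompact_holds (g.toContMDiffRiemannianMetric hg) le_rfl
      isCompact_univ
  · simp [PseudoRiemannianMetric.riemVolume, hg]

/-- **A nonempty closed Riemannian manifold has positive volume** (`riemannianVolume_pos_of_isOpen`,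
Federer 1969, §3.2.46). [folklore] -/
theorem _root_.Literature.Geometry.Lorentzian.PseudoRiemannianMetric.riemVolume_univ_pos
    [I.Boundaryless] [Nonempty M] {g : PseudoRiemannianMetric I ∞ E (TangentSpace I : M → Type _)}
    (hg : g.IsRiemannian) : 0 < g.riemVolume univ := by
  rw [PseudoRiemannianMetric.riemVolume_eq hg]
  exact riemannianVolume_pos_of_isOpen (g.toContMDiffRiemannianMetric hg) isOpen_univ univ_nonempty

/-- **Compatible constants exist** on a nonempty closed Riemannian manifold: for `τ > 0` the
constant `c = log [(4πτ)^{-n/2} Vol(M)]` satisfies `∫ (4πτ)^{-n/2} e^{-c} dV = 1`. (So the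
admissible class in `μ(g, τ)` is nonempty; Topping 2006, §8.1.) [folklore] -/
theorem _root_.Literature.Geometry.Lorentzian.PseudoRiemannianMetric.exists_const_isEntropyCompatible
    [I.Boundaryless] [CompactSpace M] [Nonempty M]
    {g : PseudoRiemannianMetric I ∞ E (TangentSpace I : M → Type _)} (hg : g.IsRiemannian)
    {τ : ℝ} (hτ : 0 < τ) : ∃ c : ℝ, g.IsEntropyCompatible (fun _ : M ↦ c) τ := by
  set V : ℝ := (g.riemVolume univ).toReal with hV
  have hVpos : 0 < V :=
    ENNReal.toReal_pos (PseudoRiemannianMetric.riemVolume_univ_pos hg).ne' g.riemVolume_univ_lt_top.ne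
  set A : ℝ := (4 * Real.pi * τ) ^ (-(finrank ℝ E : ℝ) / 2) with hA
  have hApos : 0 < A := entropyNormalisation_pos _ hτ
  refine ⟨Real.log (A * V), ?_⟩
  rw [PseudoRiemannianMetric.isEntropyCompatible_iff, integral_entropyDensity_const, ← hV, ← hA,
    Real.exp_neg, Real.exp_log (mul_pos hApos hVpos)]
  field_simp

/-- **`μ(g, τ) < ⊤`** on a nonempty closed Riemannian manifold, `τ > 0` (the admissible class
contains a constant). [folklore] -/
theorem _root_.Literature.Geometry.Lorentzian.PseudoRiemannianMetric.muEntropy_lt_top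
    [I.Boundaryless] [CompactSpace M] [Nonempty M]
    {g : PseudoRiemannianMetric I ∞ E (TangentSpace I : M → Type _)} (hg : g.IsRiemannian)
    (cov : CovariantDerivative I E (TangentSpace I : M → Type _)) {τ : ℝ} (hτ : 0 < τ) :
    g.muEntropy cov τ < ⊤ := by
  obtain ⟨c, hc⟩ := PseudoRiemannianMetric.exists_const_isEntropyCompatible hg hτ
  exact (PseudoRiemannianMetric.muEntropy_le contMDiff_const hc).trans_lt (EReal.coe_lt_top _)

/-- **`𝒲` at a compatible constant**: `𝒲(g, c, τ) = τ ∫ R u dV + (c - n)` when `f ≡ c` is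
compatible (`|∇c|² = 0`, `∫ u dV = 1`), provided `R u` is integrable (e.g. on a closed manifold).
[cite: Topping2006, §8.1, definition of 𝒲] -/
theorem _root_.Literature.Geometry.Lorentzian.PseudoRiemannianMetric.wEntropy_const
    {g : PseudoRiemannianMetric I ∞ E (TangentSpace I : M → Type _)}
    (cov : CovariantDerivative I E (TangentSpace I : M → Type _)) {c τ : ℝ}
    (hc : g.IsEntropyCompatible (fun _ : M ↦ c) τ)
    (hR : Integrable (fun x ↦ g.scalarCurvatureWith cov x *
      entropyDensity (finrank ℝ E) (fun _ : M ↦ c) τ x) g.riemVolume) :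
    g.wEntropy cov (fun _ ↦ c) τ =
      τ * ∫ x, g.scalarCurvatureWith cov x * entropyDensity (finrank ℝ E) (fun _ : M ↦ c) τ x
        ∂g.riemVolume + (c - finrank ℝ E) := by
  have hu := hc.integrable
  rw [PseudoRiemannianMetric.wEntropy_def]
  simp only [PseudoRiemannianMetric.gradSq_const, add_zero]
  have hsplit : ∀ x, (τ * g.scalarCurvatureWith cov x + c - finrank ℝ E) *
      entropyDensity (finrank ℝ E) (fun _ : M ↦ c) τ x =
      τ * (g.scalarCurvatureWith cov x * entropyDensity (finrank ℝ E) (fun _ : M ↦ c) τ x) +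
        (c - finrank ℝ E) * entropyDensity (finrank ℝ E) (fun _ : M ↦ c) τ x := fun x ↦ by ring
  simp_rw [hsplit]
  rw [integral_add (hR.const_mul τ) (hu.const_mul _), integral_const_mul, integral_const_mul,
    hc, mul_one]

end Entropy

end Literature.Geometry.Riemannian

end
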